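import Summits.QuantumFields.GaugeBoot.FluctuationMergeAppend
import HarnessLib

/-!
# Fluctuations of Wilson loops, IV: centered block products (gauge-boot, ADDENDUM 32 part D)

HONEST FRAMING (cell `pub-gaugeboot`, page 1 of every file): the venture produces certified bounds
on lattice expectations at stated coupling, gauge group, dimension and torus size; NOT a mass gap,
NOT a continuum limit, NOT a string tension; NOT Yang–Mills-summit-bearing (barriers
`FixedCouplingUltralocality`, `PerturbativeInvisibility`).  Strong-coupling `SO(N)` lattice gauge theory with free boundary
condition (S. Chatterjee, Comm. Math. Phys. **366** (2019); S. Chatterjee, J. Jafarov, arXiv:1604.04777); nothing about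
four-dimensional continuum Yang–Mills or a mass gap.

## Content

The algebraic skeleton of the lane's fluctuation programme, over an arbitrary commutative ring `R` (later: truncated power
series in `X = 1/N`).  Data: a "moment functional" `p : 𝒮 → R` with `p(∅) = 1`, invariant under permutations of the components
of genuine loop sequences; the CENTERED BLOCK PRODUCT `G(B₀; C₁, …, C_m) ∈ R` — the algebraic counterpart of
`E[(Π_{l∈B₀} W_l/N) · Π_j (Π_{l∈C_j} W_l/N − E Π_{l∈C_j} W_l/N)]` — is characterised (no `def`) by the first-block recursion
`G(B₀; ∅) = p(B₀)`, `G(B₀; C :: rest) = G(B₀ ++ C; rest) − p(C)·G(B₀; rest)` (`centered_exists`: such a `G` exists).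
Lemmas: an empty centered block kills `G` (`centered_nil_block`, `centered_of_mem_nil`); `G` is invariant under permuting the
loops of the uncentered block and of the first centered block (`centered_perm₀`, `centered_perm_head`); a two-step unfolding
(`centered_cons_cons`).

Everything is `[new (lane)]` bookkeeping; no analytic content.
-/

noncomputable section

open Finset
open Literature.MathematicalPhysics.QuantumFieldTheory.Chatterjee2019LargeN

namespace Summit.QuantumFields.GaugeBoot

namespace StringDuality

variable {d : ℕ} {R : Type*} [CommRing R]

/-- A centered block product functional with the first-block recursion EXISTS (structural recursion on the block list).
[new (lane)] -/
theorem centered_exists (p : LoopSeq d → R) :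
    ∃ G : LoopSeq d → List (LoopSeq d) → R,
      (∀ B₀ : LoopSeq d, G B₀ [] = p B₀) ∧
      ∀ (B₀ C : LoopSeq d) (rest : List (LoopSeq d)), G B₀ (C :: rest) = G (B₀ ++ C) rest - p C * G B₀ rest :=
  ⟨fun B₀ Cs => (List.rec (motive := fun _ => LoopSeq d → R) (fun B => p B)
      (fun C _ ih => fun B => ih (B ++ C) - p C * ih B) Cs) B₀, fun _ => rfl, fun _ _ _ => rfl⟩

section basic

variable {p : LoopSeq d → R} {G : LoopSeq d → List (LoopSeq d) → R}
  (hG0 : ∀ B₀ : LoopSeq d, G B₀ [] = p B₀)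
  (hGs : ∀ (B₀ C : LoopSeq d) (rest : List (LoopSeq d)), G B₀ (C :: rest) = G (B₀ ++ C) rest - p C * G B₀ rest)
include hG0 hGs

omit hG0 in
/-- Two-step unfolding of the recursion. [new (lane)] -/
theorem centered_cons_cons (B₀ C C' : LoopSeq d) (rest : List (LoopSeq d)) :
    G B₀ (C :: C' :: rest) =
      G (B₀ ++ C ++ C') rest - p C' * G (B₀ ++ C) rest - p C * (G (B₀ ++ C') rest - p C' * G B₀ rest) := by
  rw [hGs, hGs, hGs]

omit hG0 in
/-- An EMPTY first centered block kills the centered product (`W_∅/N − ⟨W_∅/N⟩ = 1 − 1 = 0`), when `p(∅) = 1`.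
[new (lane)] -/
theorem centered_nil_block (hp1 : p [] = 1) (B₀ : LoopSeq d) (rest : List (LoopSeq d)) : G B₀ ([] :: rest) = 0 := by
  rw [hGs, List.append_nil, hp1, one_mul, sub_self]

omit hG0 in
/-- An empty centered block anywhere kills the centered product. [new (lane)] -/
theorem centered_of_mem_nil (hp1 : p [] = 1) :
    ∀ (Cs : List (LoopSeq d)), [] ∈ Cs → ∀ B₀ : LoopSeq d, G B₀ Cs = 0 := by
  intro Cs
  induction Cs with
  | nil => intro h; simp at h
  | cons C rest ih =>
    intro hmem B₀
    rcases List.mem_cons.mp hmem with h | h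
    · rw [← h]; exact centered_nil_block hGs hp1 B₀ rest
    · rw [hGs, ih h, ih h, mul_zero, sub_zero]

omit hG0 hGs in
/-- Genuineness is preserved by concatenation. [folklore] -/
theorem isLoopSeq_append {A B : LoopSeq d} (hA : IsLoopSeq A) (hB : IsLoopSeq B) : IsLoopSeq (A ++ B) := by
  intro l hl
  rcases List.mem_append.mp hl with h | h
  · exact hA l h
  · exact hB l h

omit hG0 hGs in
/-- Genuineness is preserved by permutations. [folklore] -/
theorem isLoopSeq_of_perm {A A' : LoopSeq d} (hA : IsLoopSeq A) (h : A.Perm A') : IsLoopSeq A' :=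
  fun l hl => hA l (h.mem_iff.mpr hl)

/-- **Permutation invariance in the uncentered block**: if `p` is invariant under permutations of the components of genuine
loop sequences, so is `G` in `B₀` (all blocks genuine). [new (lane)] -/
theorem centered_perm₀ (hpPerm : ∀ s s' : LoopSeq d, IsLoopSeq s → s.Perm s' → p s = p s') :
    ∀ (Cs : List (LoopSeq d)), (∀ C ∈ Cs, IsLoopSeq C) →
      ∀ B₀ B₀' : LoopSeq d, IsLoopSeq B₀ → B₀.Perm B₀' → G B₀ Cs = G B₀' Cs := by
  intro Cs
  induction Cs with
  | nil =>
    intro _ B₀ B₀' hB h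
    rw [hG0, hG0, hpPerm B₀ B₀' hB h]
  | cons C rest ih =>
    intro hCs B₀ B₀' hB h
    have hC : IsLoopSeq C := hCs C (by simp)
    have hrest : ∀ C' ∈ rest, IsLoopSeq C' := fun C' hC' => hCs C' (List.mem_cons_of_mem C hC')
    rw [hGs, hGs, ih hrest (B₀ ++ C) (B₀' ++ C) (isLoopSeq_append hB hC) (h.append_right C), ih hrest B₀ B₀' hB h]

/-- **Permutation invariance in the first centered block**. [new (lane)] -/
theorem centered_perm_head (hpPerm : ∀ s s' : LoopSeq d, IsLoopSeq s → s.Perm s' → p s = p s')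
    {C C' : LoopSeq d} (hC : IsLoopSeq C) (h : C.Perm C') {rest : List (LoopSeq d)} (hrest : ∀ C'' ∈ rest, IsLoopSeq C'')
    {B₀ : LoopSeq d} (hB : IsLoopSeq B₀) : G B₀ (C :: rest) = G B₀ (C' :: rest) := by
  rw [hGs, hGs, centered_perm₀ hG0 hGs hpPerm rest hrest (B₀ ++ C) (B₀ ++ C') (isLoopSeq_append hB hC) (h.append_left B₀),
    hpPerm C C' hC h]

/-- If two functionals satisfy the recursion for the same `p`, they coincide (structural induction). [new (lane)] -/
theorem centered_unique {G' : LoopSeq d → List (LoopSeq d) → R} (hG0' : ∀ B₀ : LoopSeq d, G' B₀ [] = p B₀)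
    (hGs' : ∀ (B₀ C : LoopSeq d) (rest : List (LoopSeq d)), G' B₀ (C :: rest) = G' (B₀ ++ C) rest - p C * G' B₀ rest) :
    ∀ (Cs : List (LoopSeq d)) (B₀ : LoopSeq d), G B₀ Cs = G' B₀ Cs := by
  intro Cs
  induction Cs with
  | nil => intro B₀; rw [hG0, hG0']
  | cons C rest ih => intro B₀; rw [hGs, hGs', ih, ih]

end basic

end StringDuality

end Summit.QuantumFields.GaugeBoot

end
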